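/-
Copyright (c) 2026 the pub-hodgecm-mathlib formalisation cell (harness21).  Prover seat hodgecm-mathlib-K2E4-p11 (g8): Track B «K2-LIT»,
#184♮ = hLiu418 = stmt-HodgeConjecture-24832; socket #41 open surface (u-0c) — file I4, EDITION 5 «PREIMAGE LEVEL» as a NEW file over ★ ED. 4 p862508
(LEAD F0P6-plan (g14) BATCH #82 (1); desk K2E5-p17 (g9) 22:29:42Z acceptance shape; ★ p862505 (K2Liu-p12) level letters; I3 ED. 2 (K2Liu-p12)).
THEOREMS ONLY (no `def`, no `instance`, no `notation`, no named-fact hypothesis, no `sorry`).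
-/
import Summits.HodgeConjecture.HodgeConjecture.Theorems.K2LiuSiegelEisensteinMiddleTermOfStandard   -- ★ p862508 (this seat) ED. 4: `exists_norm_xi_det_levi_le`, `innerFamily_laws` (+ ★ ED. 2, ★ ED. 3, ★ I1, ★ I2, ★ p862178 by import)
import Summits.HodgeConjecture.HodgeConjecture.Theorems.K2LiuSiegelMiddleTermLevelLettersNhds      -- 📤 p862660 (this seat over ★ p862505∕p862552 K2Liu-p12): `exists_level_letters_of_blk_of_nhds`
import Summits.HodgeConjecture.HodgeConjecture.Theorems.K2LiuGL2LevelConjugate                   -- ★ p862608 (this seat): `exists_level_conj` (`hlevN`)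
import Summits.HodgeConjecture.HodgeConjecture.Theorems.K2LiuSiegelMiddleTermKTypesLevel         -- ★ p862687 (K2Liu-p12) I3 ED. 2: `exists_KTypes_package_level`
import Literature.NumberTheory.Automorphic.GLnAdelicStructureProofs                              -- ★ `GLn.continuous_ofFinite`
import Literature.NumberTheory.Automorphic.ReductionTheoryGLn                                    -- ★ `glIntegralLevel_le_standardMaximalCompactGL`
import HarnessLib

/-!
# Crux `HLiu418`, socket #41, (u-0c) FILE I4 ED. 5 — `K2LiuSiegelEisensteinMiddleTermOfStandardLevel`: THE MIDDLE-CELL TERM PACKAGE OF A STANDARD FAMILY AT THE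
# PREIMAGE LEVEL — the level letters PAID (★ p862505) and the chart tie `Λ(K_{GL₂}) ⊆ 𝒦.K` WEAKENED to a finite-index open `KG ≤ K_{GL₂}` with `Λ(KG) ⊆ 𝒦.K`

Cell `hodgecm-mathlib`, crux item hLiu418 = `stmt-HodgeConjecture-24832`; squad K2 ∕ K2Liu (L1, LEAD F0P6-plan (g14)), road `K2_Liu`, socket #41; desk K2E5-p17 (g9).
Lane `--supports stmt-HodgeConjecture-24832 --as helper` (count-neutral helper; closes no socket by itself).  FRAME `e : Fin N × Fin M ≃ Fin 2` LITERAL.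

THE MATHEMATICS [MoeglinWaldspurger1995, II.1.7, IV.1.9], [BorelJacquet1979, §1.1, §4.1], [Tan1999, §1, §4 Prop. 4.8].  RULING M-158j (HYBRID road): the socket
quantifies over an ARBITRARY standard Iwasawa datum `𝒦` (`𝒦.IsStd`), whose finite part `C_f` is an arbitrary open compact subgroup of `H(𝔸_f)` — so the Levi chart `Λ`
need not carry `GL₂(𝒪̂_L)` into `C_f`; what is generic-true is that `KG := Λ⁻¹(𝒦.K) ∩ K_{GL₂}` is OPEN of FINITE INDEX in `K_{GL₂} = GL₂(𝒪̂_L)·K_∞` (finite part by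
openness of `C_f` and continuity of `Λ`; archimedean part all of `K_∞` at the (R-c)-adapted datum).  THIS FILE re-cuts ★ ED. 4 accordingly:
* §1 `exists_KHType_translates` — the PER-TRANSLATE `K_H`-TYPE LETTER: for every `k ∈ K_{GL₂}` the left translate `h ↦ F_s(Λ k · h)` of the inner section has a finite
  `K_H`-type on `𝒦.K` (★ p862178 `exists_KHType_of_standard` at `a := u ↦ u·Λ k` — its `a` is generic), from the analytic letters `hint`, `hFhol` on ALL of `H(𝔸)`;
* §2 HEAD **`exists_middleTerm_package_of_standard_level`** — ★ ED. 4's head with (i) the nine level binders `S γl hγ0 hγ1 hχlev U hUK s₀ hfU hΛU` DISCHARGED by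
  ★ p862505 `exists_level_letters` (visible instead: `h𝒦 : 𝒦.IsStd` and the chart letter `hΛ1 : (Λ(1,r))_∞ = 1`), and (ii) `hΛK : Λ(K_{GL₂}) ⊆ 𝒦.K` WEAKENED to the
  desk's block `KG hKG hKGo hKGfi (hΛK : ∀ k ∈ KG, Λ k ∈ 𝒦.K)` through I3 ED. 2 `K2LiuSiegelMiddleTermKTypesLevel` (K2Liu-p12); output = ★ ED. 2's four conjuncts VERBATIM.
HONEST LABEL.  Count-neutral helper; it retires nothing by itself: `HC_CM` is proved only modulo the 7 printed citations (2 remaining named inputs: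
hLiu418 = `stmt-HodgeConjecture-24832`, h413 = `stmt-HodgeConjecture-24833`) until rung 0 closes.

## References
* [MoeglinWaldspurger1995] C. Mœglin, J.-L. Waldspurger, *Spectral decomposition and Eisenstein series* (1995), I.2.2, II.1.7, IV.1.9.
* [BorelJacquet1979] A. Borel, H. Jacquet, *Automorphic forms and automorphic representations*, Corvallis I (1979), §1.1, §4.1.
* [Tan1999] V. Tan, *Poles of Siegel Eisenstein series on U(n,n)*, Canad. J. Math. 51 (1999), §1 p. 166, §4 Prop. 4.8.
* [KudlaRallis1994] S. Kudla, S. Rallis, Ann. of Math. 140 (1994), §2 (2.10)–(2.12).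
-/

set_option autoImplicit false
set_option linter.dupNamespace false -- the mandated namespace repeats `HodgeConjecture.HodgeConjecture`

noncomputable section

open scoped Matrix ENNReal NNReal
open NumberField IsDedekindDomain MeasureTheory MeasureTheory.Measure Filter Set Function Topology Metric
open Literature.NumberTheory.Automorphic Literature.NumberTheory.Automorphic.UnitaryGroup Literature.NumberTheory.GaloisRepresentations
open Literature.NumberTheory.Automorphic.IdeleClassGroup
open Literature.NumberTheory.GelbartRogawski1991 Literature.NumberTheory.GelbartRogawski1991.GRConstruction
open Literature.NumberTheory.GelbartRogawski1991.AdaptedBlocks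
open Literature.NumberTheory.K2Lit.SiegelDoubled Literature.MeasureTheory.Group
open UnitaryDualPair
open Summit.HodgeConjecture.HodgeConjecture.Cruxes.HLiu418.K2LiuUnipotentCoveringWeight
open Summit.HodgeConjecture.HodgeConjecture.Cruxes.HLiu418.K2LiuGL2FlatSectionFiniteData (ofFinite_mem)
open Summit.HodgeConjecture.HodgeConjecture.Cruxes.HLiu418.K2LiuSiegelMiddleCellLeviCriterion (row_ne_zero)
open Summit.HodgeConjecture.HodgeConjecture.Cruxes.HLiu418.K2LiuMiddleInnerSectionHolomorphic (differentiableOn_phi₂)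
open Summit.HodgeConjecture.HodgeConjecture.Cruxes.HLiu418.K2LiuMiddleTermRowSection (exists_rowSection₂)
open Summit.HodgeConjecture.HodgeConjecture.Cruxes.HLiu418.K2LiuSiegelIwasawaLeviCoordinate (exists_iwasawaLeviCoordinate)
open Summit.HodgeConjecture.HodgeConjecture.Cruxes.HLiu418.K2LiuSiegelMiddleTermDetCharacter (exists_halfNormTwist)
open Summit.HodgeConjecture.HodgeConjecture.Cruxes.HLiu418.K2LiuSiegelMiddleTermInnerKTypeOfStandard (exists_KHType_of_standard)
open Summit.HodgeConjecture.HodgeConjecture.Cruxes.HLiu418.K2LiuSiegelMiddleTermIdentification (xi_det_map_eq_one middleTerm_eq_tsum_untwisted)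
open Summit.HodgeConjecture.HodgeConjecture.Cruxes.HLiu418.K2LiuSiegelEisensteinMiddleTermContinuous (exists_middleTerm_package')
open Summit.HodgeConjecture.HodgeConjecture.Cruxes.HLiu418.K2LiuSiegelEisensteinMiddleTermOfStandard (exists_norm_xi_det_levi_le innerFamily_laws)
open Summit.HodgeConjecture.HodgeConjecture.Cruxes.HLiu418.K2LiuSiegelMiddleTermLevelLettersNhds (exists_level_letters_of_blk_of_nhds)
open Summit.HodgeConjecture.HodgeConjecture.Cruxes.HLiu418.K2LiuGL2LevelConjugate (exists_level_conj)
open Summit.HodgeConjecture.HodgeConjecture.Cruxes.HLiu418.K2LiuSiegelMiddleTermKTypesLevel (exists_KTypes_package_level)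

namespace Summit.HodgeConjecture.HodgeConjecture.Cruxes.HLiu418.K2LiuSiegelEisensteinMiddleTermOfStandardLevel

variable (L : Type) [Field L] [NumberField L] [IsCMField L]
variable {N M : ℕ} (e : Fin N × Fin M ≃ Fin 2)
  (dV : Fin N → L) (hdV : ∀ i, IsCMField.complexConj L (dV i) = dV i)
  (dW : Fin M → L) (hdW : ∀ i, IsCMField.complexConj L (dW i) = dW i)
variable [MeasurableSpace (unipDelta L e dV hdV dW hdW)] [BorelSpace (unipDelta L e dV hdV dW hdW)]

/-! ## §1 The per-translate `K_H`-type letter -/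

omit [BorelSpace (unipDelta L e dV hdV dW hdW)] in
/-- **THE LEFT TRANSLATES `h ↦ F_s(Λ k · h)` OF THE INNER SECTION HAVE A FINITE `K_H`-TYPE ON `𝒦.K`** (`f` STANDARD; every `k ∈ K_{GL₂}`), in ★ I3's currency: the matrix-coefficient
law for ALL `h`, the expansion `F_s(Λ k · h) = Σ_j c_j(h) G_j(s)` on `𝒦.K` (`0 < re s`), continuity, sup bounds on `𝒦.K` and the level `U` of the `c_j` — ★ p862178
`exists_KHType_of_standard` for the translate `F^k_s(h) := F_s(Λ k · h) = ∫ β₁(u) • f_s(w₀·((u·Λ k)·h)) dνN(u)` (its slice map `a := u ↦ u·Λ k` is generic), from the analytic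
letters `hint` (integrability) and `hFhol` (holomorphy, hence continuity in `s`) on ALL of `H(𝔸)`. [cite: MoeglinWaldspurger1995, II.1.7, IV.1.9] [cite: Tan1999, §1]
[cite: BorelJacquet1979, §4.1] -/
theorem exists_KHType_translates (𝒦 : IwasawaDatum L e dV hdV dW hdW) {χ : HeckeCharacter L}
    {f : ℂ → HA L e dV hdV dW hdW → ℂ} (hstd : IsStandardSectionFamily 𝒦 χ f) (hcont : ∀ s : ℂ, Continuous (f s))
    (Λ : GL (Fin 2) (AdeleRing (𝓞 L) L) →* HA L e dV hdV dW hdW)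
    (νN : Measure (unipDelta L e dV hdV dW hdW)) (β₁ : unipDelta L e dV hdV dW hdW → ℝ≥0∞) (w₀ : HA L e dV hdV dW hdW) (F : ℂ → HA L e dV hdV dW hdW → ℂ)
    (hF : ∀ (s : ℂ) (x : HA L e dV hdV dW hdW), F s x = ∫ u, (β₁ u).toReal • f s (w₀ * ((u : HA L e dV hdV dW hdW) * x)) ∂νN)
    (hint : ∀ s : ℂ, 0 < s.re → ∀ y : HA L e dV hdV dW hdW,
      Integrable (fun u : unipDelta L e dV hdV dW hdW => (β₁ u).toReal • f s (w₀ * ((u : HA L e dV hdV dW hdW) * y))) νN)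
    (hFhol : ∀ y : HA L e dV hdV dW hdW, DifferentiableOn ℂ (fun s => F s y) {s : ℂ | 0 < s.re})
    (U : Subgroup (HA L e dV hdV dW hdW)) (hUK : ∀ k ∈ 𝒦.K, ∀ u ∈ U, k⁻¹ * u * k ∈ U)
    (s₀ : ℂ) (hfU : ∀ (g : HA L e dV hdV dW hdW), ∀ u ∈ U, f s₀ (g * u) = f s₀ g)
    (k : ↥(standardMaximalCompactGL 2 L)) :
    ∃ (ι : Type) (_ : Fintype ι) (c : ι → HA L e dV hdV dW hdW → ℂ) (Mc : ι → ι → HA L e dV hdV dW hdW → ℂ) (G : ι → ℂ → ℂ),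
      (∀ (j : ι) (h k₁ : HA L e dV hdV dW hdW), k₁ ∈ 𝒦.K → c j (h * k₁) = ∑ l, Mc j l k₁ * c l h) ∧
      (∀ s : ℂ, 0 < s.re → ∀ h ∈ 𝒦.K, F s (Λ k * h) = ∑ j, c j h * G j s) ∧
      (∀ j, ContinuousOn (G j) {s : ℂ | 0 < s.re}) ∧
      (∀ j, Continuous (c j)) ∧
      (∃ Cc : ℝ, ∀ j, ∀ h ∈ 𝒦.K, ‖c j h‖ ≤ Cc) ∧
      (∃ CM : ℝ, ∀ j l, ∀ k₁ ∈ 𝒦.K, ‖Mc j l k₁‖ ≤ CM) ∧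
      (∀ (j : ι) (h : HA L e dV hdV dW hdW), ∀ u ∈ U, c j (h * u) = c j h) :=
  exists_KHType_of_standard 𝒦 hstd s₀ (hcont s₀) νN β₁ w₀ (fun u : unipDelta L e dV hdV dW hdW => (u : HA L e dV hdV dW hdW) * Λ k)
    (fun s h => F s (Λ k * h)) (fun s y => by rw [hF]; simp only [mul_assoc]) (fun s hs y _ => by simpa only [mul_assoc] using hint s hs (Λ k * y))
    (fun y _ => (hFhol (Λ k * y)).continuousOn) U hUK hfU

/-! ## The `n = 2` datum (★ α3-2's variable block VERBATIM) -/

variable {g₀ : UnitaryGroup.rationalPair (Fp L) L (IsCMField.complexConj L) N M (Matrix.diagonal dV) (Matrix.diagonal dW)}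
  (hg₀ : ((g₀ : GL (Fin N × Fin M) L) : Matrix (Fin N × Fin M) (Fin N × Fin M) L) = Matrix.diagonal (fun k => 1 - 2 * (![0, 1] : Fin 2 → L) (e k)))
  (Λ : GL (Fin 2) (AdeleRing (𝓞 L) L) →* HA L e dV hdV dW hdW)
  (hΛ : ∀ g : GL (Fin 2) (AdeleRing (𝓞 L) L), blk L e dV hdV dW hdW (Λ g) =
    cayR (AdeleRing (𝓞 L) L) (Fin 2) * Matrix.fromBlocks (g : Matrix (Fin 2) (Fin 2) (AdeleRing (𝓞 L) L)) 0 0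
      (((gramR L e dV hdV dW hdW).map ((algebraMap L (AdeleRing (𝓞 L) L)).comp (algebraMap (Fp L) L)))⁻¹ *
        (((g⁻¹ : GL (Fin 2) (AdeleRing (𝓞 L) L)) : Matrix (Fin 2) (Fin 2) (AdeleRing (𝓞 L) L)).map
          (conjAdele (Fp L) L (IsCMField.complexConj L)))ᵀ *
        (gramR L e dV hdV dW hdW).map ((algebraMap L (AdeleRing (𝓞 L) L)).comp (algebraMap (Fp L) L))) *
      cayRinv (AdeleRing (𝓞 L) L) (Fin 2))
  (Γ₀ : Subgroup (unipDelta L e dV hdV dW hdW))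
  (hΓ₀ : ∀ u : unipDelta L e dV hdV dW hdW, u ∈ Γ₀ ↔ (u : HA L e dV hdV dW hdW) ∈ ratH L e dV hdV dW hdW ∧
    IsSiegelDelta L e dV hdV dW hdW (iotaGG L e dV hdV dW hdW (1, UnitaryGroup.rationalPairToAdelic (Fp L) L (IsCMField.complexConj L) N M (Matrix.diagonal dV) (Matrix.diagonal dW) g₀) * (u : HA L e dV hdV dW hdW) * (iotaGG L e dV hdV dW hdW (1, UnitaryGroup.rationalPairToAdelic (Fp L) L (IsCMField.complexConj L) N M (Matrix.diagonal dV) (Matrix.diagonal dW) g₀))⁻¹))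
  (wq : unipDeltaRat L e dV hdV dW hdW → ratH L e dV hdV dW hdW)
  (hwq : ∀ ν, ((wq ν : ratH L e dV hdV dW hdW) : HA L e dV hdV dW hdW) =
    weylDelta L e dV hdV dW hdW * ((ν : unipDelta L e dV hdV dW hdW) : HA L e dV hdV dW hdW))

/-! ## §1c The preimage-level letters: one `GL₂`-level inside `{r | (1,r) ∈ KG}` carrying `hχlev`, `U`, `hΛU`, `hlevKG`, `hlevN` -/

omit [MeasurableSpace (unipDelta L e dV hdV dW hdW)] [BorelSpace (unipDelta L e dV hdV dW hdW)] in
include hΛ in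
/-- **THE PREIMAGE-LEVEL LETTERS** for a STANDARD datum `𝒦`, a STANDARD family `f`, the chart's Levi homomorphism `Λ` (continuous) and an OPEN `KG ≤ K_{GL₂}`: ONE principal congruence
level `(S, γl)` (`0 ≠ γ_v < 1`) with the conductor letter `hχlev`, a level subgroup `U ≤ H(𝔸)` of `f_0` normalised by `𝒦.K` with `Λ(1,r) ∈ U` on the level, `(1,r) ∈ KG` on the level
(`hlevKG`: 📤 p862660 `exists_level_letters_of_blk_of_nhds` at `W₀ := {r | (1,r) ∈ O}` for an open `O ⊆ GL₂(𝔸_L)` with `O ∩ K_{GL₂} = KG ∩ K_{GL₂}`), and the `K_{GL₂}`-conjugates of the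
level in the level (`hlevN`: ★ p862608 `exists_level_conj`). [cite: BorelJacquet1979, §1.1, §4.1] [cite: PlatonovRapinchuk1994, §5.1] [cite: NeukirchANT1999, VII §6 (6.11)] -/
theorem exists_preimage_level_letters (hdV0 : ∀ i, dV i ≠ 0) (hdW0 : ∀ i, dW i ≠ 0) {𝒦 : IwasawaDatum L e dV hdV dW hdW} (h𝒦 : 𝒦.IsStd) {χ : HeckeCharacter L}
    {f : ℂ → HA L e dV hdV dW hdW → ℂ} (hstd : IsStandardSectionFamily 𝒦 χ f) (hcont : ∀ s : ℂ, Continuous (f s)) (hΛc : Continuous Λ)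
    (KG : Subgroup (GL (Fin 2) (AdeleRing (𝓞 L) L)))
    (hKGo : IsOpen ((KG.subgroupOf (standardMaximalCompactGL 2 L) : Subgroup ↥(standardMaximalCompactGL 2 L)) : Set ↥(standardMaximalCompactGL 2 L))) :
    ∃ (S : Finset (HeightOneSpectrum (𝓞 L))) (γl : ∀ v : HeightOneSpectrum (𝓞 L), ValuativeRel.ValueGroupWithZero (v.adicCompletion L)),
      (∀ v ∈ S, γl v ≠ 0) ∧ (∀ v ∈ S, γl v < 1) ∧
      (∀ r : GL (Fin 2) (FiniteAdeleRing (𝓞 L) L), r ∈ glFiniteIntegralLevel 2 L → (∀ v ∈ S, GLn.evalAt 2 L v r ∈ congruenceGL 2 (γl v)) →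
        χ (Matrix.GeneralLinearGroup.det (GLn.ofFinite 2 L r)) = 1) ∧
      (∀ r : GL (Fin 2) (FiniteAdeleRing (𝓞 L) L), r ∈ glFiniteIntegralLevel 2 L → (∀ v ∈ S, GLn.evalAt 2 L v r ∈ congruenceGL 2 (γl v)) →
        GLn.ofFinite 2 L r ∈ KG) ∧
      (∀ r : GL (Fin 2) (FiniteAdeleRing (𝓞 L) L), r ∈ glFiniteIntegralLevel 2 L → (∀ v ∈ S, GLn.evalAt 2 L v r ∈ congruenceGL 2 (γl v)) →
        ∀ k : ↥(standardMaximalCompactGL 2 L), ∃ r' : GL (Fin 2) (FiniteAdeleRing (𝓞 L) L), r' ∈ glFiniteIntegralLevel 2 L ∧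
          (∀ v ∈ S, GLn.evalAt 2 L v r' ∈ congruenceGL 2 (γl v)) ∧
          ((k : GL (Fin 2) (AdeleRing (𝓞 L) L)))⁻¹ * GLn.ofFinite 2 L r * k = GLn.ofFinite 2 L r') ∧
      ∃ U : Subgroup (HA L e dV hdV dW hdW),
        (∀ k ∈ 𝒦.K, ∀ u ∈ U, k⁻¹ * u * k ∈ U) ∧
        (∀ (g : HA L e dV hdV dW hdW), ∀ u ∈ U, f 0 (g * u) = f 0 g) ∧
        ∀ r : GL (Fin 2) (FiniteAdeleRing (𝓞 L) L), r ∈ glFiniteIntegralLevel 2 L → (∀ v ∈ S, GLn.evalAt 2 L v r ∈ congruenceGL 2 (γl v)) →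
          Λ (GLn.ofFinite 2 L r) ∈ U := by
  -- the neighbourhood `W₀ := {r | (1,r) ∈ O}`, `O ∩ K_{GL₂} = KG ∩ K_{GL₂}` open
  obtain ⟨O, hOo, hOK⟩ := isOpen_induced_iff.1 hKGo
  have hW₀ : (GLn.ofFinite 2 L) ⁻¹' O ∈ 𝓝 (1 : GL (Fin 2) (FiniteAdeleRing (𝓞 L) L)) := by
    refine (hOo.preimage (GLn.continuous_ofFinite (n := 2) (K := L))).mem_nhds ?_
    have h1 : (⟨1, (standardMaximalCompactGL 2 L).one_mem⟩ : ↥(standardMaximalCompactGL 2 L)) ∈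
        (Subtype.val ⁻¹' O : Set ↥(standardMaximalCompactGL 2 L)) := by
      rw [hOK]
      exact (KG.subgroupOf (standardMaximalCompactGL 2 L)).one_mem
    rw [Set.mem_preimage, map_one]
    exact h1
  -- the level letters inside `W₀` (📤 p862660 over ★ p862505∕p862552)
  obtain ⟨S, γl, hγ0, hγ1, hlevW, hχlev, U, hUK, hfU, hΛU⟩ :=
    exists_level_letters_of_blk_of_nhds L e dV hdV dW hdW hdV0 hdW0 h𝒦 (f 0) (hstd.2.1 0) (hcont 0) χ Λ hΛ hΛc _ hW₀
  refine ⟨S, γl, hγ0, hγ1, hχlev, fun r hr hrS => ?_, fun r hr hrS k => exists_level_conj S γl hr hrS k.2, U, hUK, hfU, hΛU⟩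
  have hmemK : GLn.ofFinite 2 L r ∈ standardMaximalCompactGL 2 L := glIntegralLevel_le_standardMaximalCompactGL (GLn.ofFinite_mem_glIntegralLevel hr)
  have hO : (⟨GLn.ofFinite 2 L r, hmemK⟩ : ↥(standardMaximalCompactGL 2 L)) ∈ (Subtype.val ⁻¹' O : Set ↥(standardMaximalCompactGL 2 L)) := hlevW r hr hrS
  rw [hOK] at hO
  exact Subgroup.mem_subgroupOf.1 hO

/-! ## §1d The `W`-package at the preimage level, level letters inside: ★ I3 ED. 2 over §1, §1c and ★ ED. 4 §1 -/

omit [BorelSpace (unipDelta L e dV hdV dW hdW)] in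
include hΛ in
/-- **THE `W`-PACKAGE AND `hφW`, `hφbd` AT THE PREIMAGE LEVEL, THE LEVEL BUILT INSIDE** for a STANDARD family and the untwisted inner family `φ s x g = a g · b x · F_s(Λ g · k_x)` (`a = ξ(det ·)⁻¹`,
`b x = ξ(det m_x)`, `ξ = χ·|·|^{½}` continuous, `χ` unitary; `m_x, k_x` the Iwasawa–Levi coordinate; `Λ` continuous; `KG ≤ K_{GL₂}` open of finite index with `Λ(KG) ⊆ 𝒦.K`)
with its Borel laws BY VALUE; the level letters `S γl hχlev U hUK hfU hΛU hlevKG hlevN` come from §1c (`𝒦.IsStd`, the chart letter `hΛ`); the per-translate `K_H`-types (§1) feed ★ I3 ED. 2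
`exists_KTypes_package_level` (letters `ha_mul hCa ha_cont ha_lev` ★ `K2LiuSiegelMiddleTermDetCharacter`, `hb` ★ ED. 4 §1 `exists_norm_xi_det_levi_le`) — ★ (β0-4)′'s binders
`W hWstab hWlaw hWlev hWcont hWext hφW hφbd` VERBATIM at `height := ‖·‖_{GL₄(𝔸_L)}`, behind `∃ S γl, hγ0 ∧ hγ1 ∧ …`. [cite: MoeglinWaldspurger1995, II.1.7, IV.1.9] [cite: BorelJacquet1979, §1.1, §4.1] [cite: Tan1999, §1] -/
theorem exists_KTypes_package_of_standard_level (hdV0 : ∀ i, dV i ≠ 0) (hdW0 : ∀ i, dW i ≠ 0) {𝒦 : IwasawaDatum L e dV hdV dW hdW} (h𝒦 : 𝒦.IsStd)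
    {χ : HeckeCharacter L} (hχ : χ.IsUnitary)
    {f : ℂ → HA L e dV hdV dW hdW → ℂ} (hstd : IsStandardSectionFamily 𝒦 χ f) (hcont : ∀ s : ℂ, Continuous (f s)) (hΛc : Continuous Λ)
    (KG : Subgroup (GL (Fin 2) (AdeleRing (𝓞 L) L)))
    (hKGo : IsOpen ((KG.subgroupOf (standardMaximalCompactGL 2 L) : Subgroup ↥(standardMaximalCompactGL 2 L)) : Set ↥(standardMaximalCompactGL 2 L)))
    (hKGfi : (KG.subgroupOf (standardMaximalCompactGL 2 L)).FiniteIndex) (hΛK : ∀ k ∈ KG, Λ k ∈ 𝒦.K)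
    (ξ : (AdeleRing (𝓞 L) L)ˣ →* ℂˣ)
    (hξ : ∀ d : (AdeleRing (𝓞 L) L)ˣ, ((ξ d : ℂˣ) : ℂ) = ((χ d : ℂˣ) : ℂ) * ((IdeleClassGroup.ideleNorm L d : ℝ) : ℂ) ^ (1 / 2 : ℂ))
    (hξc : Continuous fun d => ((ξ d : ℂˣ) : ℂ))
    (a : GL (Fin 2) (AdeleRing (𝓞 L) L) → ℂ) (ha : ∀ g, a g = (((ξ (Matrix.GeneralLinearGroup.det g))⁻¹ : ℂˣ) : ℂ))
    (mx : HA L e dV hdV dW hdW → GL (Fin 2) (AdeleRing (𝓞 L) L)) (kx : HA L e dV hdV dW hdW → HA L e dV hdV dW hdW) (hkx : ∀ h, kx h ∈ 𝒦.K)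
    (hp : ∀ h, IsSiegelDelta L e dV hdV dW hdW (h * (kx h)⁻¹))
    (hmx : ∀ h, ((mx h : GL (Fin 2) (AdeleRing (𝓞 L) L)) : Matrix (Fin 2) (Fin 2) (AdeleRing (𝓞 L) L)) = deltaBlock L e dV hdV dW hdW (h * (kx h)⁻¹))
    (b : HA L e dV hdV dW hdW → ℂ) (hb : ∀ x, b x = ((ξ (Matrix.GeneralLinearGroup.det (mx x)) : ℂˣ) : ℂ))
    (νN : Measure (unipDelta L e dV hdV dW hdW)) (β₁ : unipDelta L e dV hdV dW hdW → ℝ≥0∞) (w₀ : HA L e dV hdV dW hdW) (F : ℂ → HA L e dV hdV dW hdW → ℂ)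
    (hF : ∀ (s : ℂ) (x : HA L e dV hdV dW hdW), F s x = ∫ u, (β₁ u).toReal • f s (w₀ * ((u : HA L e dV hdV dW hdW) * x)) ∂νN)
    (hint : ∀ s : ℂ, 0 < s.re → ∀ y : HA L e dV hdV dW hdW,
      Integrable (fun u : unipDelta L e dV hdV dW hdW => (β₁ u).toReal • f s (w₀ * ((u : HA L e dV hdV dW hdW) * y))) νN)
    (hFhol : ∀ y : HA L e dV hdV dW hdW, DifferentiableOn ℂ (fun s => F s y) {s : ℂ | 0 < s.re})
    (φ : ℂ → HA L e dV hdV dW hdW → GL (Fin 2) (AdeleRing (𝓞 L) L) → ℂ) (hφ : ∀ s x g, φ s x g = a g * b x * F s (Λ g * kx x))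
    (hφT : ∀ (s : ℂ) (x : HA L e dV hdV dW hdW), 0 < s.re → ∀ (d : Fin 2 → (AdeleRing (𝓞 L) L)ˣ) (g : GL (Fin 2) (AdeleRing (𝓞 L) L)),
      φ s x (glDiagonal 2 (AdeleRing (𝓞 L) L) d * g) =
      ((IdeleClassGroup.ideleNorm L (d 0) : ℝ) : ℂ) ^ (s + 1 / 2) * ((IdeleClassGroup.ideleNorm L (d 1) : ℝ) : ℂ) ^ (-(s + 1 / 2)) * φ s x g)
    (hφN : ∀ (s : ℂ) (x : HA L e dV hdV dW hdW), 0 < s.re → ∀ u g : GL (Fin 2) (AdeleRing (𝓞 L) L), (u : Matrix (Fin 2) (Fin 2) (AdeleRing (𝓞 L) L)) 1 0 = 0 →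
      (u : Matrix (Fin 2) (Fin 2) (AdeleRing (𝓞 L) L)) 0 0 = 1 → (u : Matrix (Fin 2) (Fin 2) (AdeleRing (𝓞 L) L)) 1 1 = 1 → φ s x (u * g) = φ s x g) :
    ∃ (S : Finset (HeightOneSpectrum (𝓞 L))) (γl : ∀ v : HeightOneSpectrum (𝓞 L), ValuativeRel.ValueGroupWithZero (v.adicCompletion L)),
      (∀ v ∈ S, γl v ≠ 0) ∧ (∀ v ∈ S, γl v < 1) ∧
    ∃ (W : Submodule ℂ (↥(standardMaximalCompactGL 2 L) → ℂ)) (_ : FiniteDimensional ℂ W),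
      (∀ B ∈ W, ∀ k₀ : ↥(standardMaximalCompactGL 2 L), (fun k => B (k * k₀)) ∈ W) ∧
      (∀ B ∈ W, ∀ p k : ↥(standardMaximalCompactGL 2 L),
        ((p : GL (Fin 2) (AdeleRing (𝓞 L) L)) : Matrix (Fin 2) (Fin 2) (AdeleRing (𝓞 L) L)) 1 0 = 0 → B (p * k) = B k) ∧
      (∀ B ∈ W, ∀ (k : ↥(standardMaximalCompactGL 2 L)) (r : GL (Fin 2) (FiniteAdeleRing (𝓞 L) L)) (hr : r ∈ glFiniteIntegralLevel 2 L),
        (∀ v ∈ S, GLn.evalAt 2 L v r ∈ congruenceGL 2 (γl v)) →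
        B ⟨(k : GL (Fin 2) (AdeleRing (𝓞 L) L)) * GLn.ofFinite 2 L r, (standardMaximalCompactGL 2 L).mul_mem k.2 (ofFinite_mem hr)⟩ = B k) ∧
      (∀ B ∈ W, Continuous B) ∧
      (∀ B ∈ W, ∃ bB : ℂ → GL (Fin 2) (AdeleRing (𝓞 L) L) → ℂ,
        (∀ s : ℂ, 0 < s.re → ∀ (d : Fin 2 → (AdeleRing (𝓞 L) L)ˣ) (g : GL (Fin 2) (AdeleRing (𝓞 L) L)),
        bB s (glDiagonal 2 (AdeleRing (𝓞 L) L) d * g) =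
        ((IdeleClassGroup.ideleNorm L (d 0) : ℝ) : ℂ) ^ (s + 1 / 2) * ((IdeleClassGroup.ideleNorm L (d 1) : ℝ) : ℂ) ^ (-(s + 1 / 2)) * bB s g) ∧
        (∀ s : ℂ, 0 < s.re → ∀ u g : GL (Fin 2) (AdeleRing (𝓞 L) L), (u : Matrix (Fin 2) (Fin 2) (AdeleRing (𝓞 L) L)) 1 0 = 0 →
        (u : Matrix (Fin 2) (Fin 2) (AdeleRing (𝓞 L) L)) 0 0 = 1 → (u : Matrix (Fin 2) (Fin 2) (AdeleRing (𝓞 L) L)) 1 1 = 1 → bB s (u * g) = bB s g) ∧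
        (∀ s : ℂ, 0 < s.re → ∀ (k : GL (Fin 2) (AdeleRing (𝓞 L) L)) (hk : k ∈ standardMaximalCompactGL 2 L), bB s k = B ⟨k, hk⟩)) ∧
      (∀ (s : ℂ) (x : HA L e dV hdV dW hdW), 0 < s.re → (fun k : ↥(standardMaximalCompactGL 2 L) => φ s x k) ∈ W) ∧
      (∀ z : ℂ, 0 < z.re → ∃ C A r : ℝ, 0 ≤ C ∧ 0 ≤ A ∧ 0 < r ∧ ∀ s : ℂ, dist s z < r →
        ∀ (x : HA L e dV hdV dW hdW) (k : ↥(standardMaximalCompactGL 2 L)), ‖φ s x k‖ ≤ C * adelicHeightGL (2 + 2) L (x : GL (Fin (2 + 2)) (AdeleRing (𝓞 L) L)) ^ A) := by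
  -- the preimage-level letters (§1c)
  obtain ⟨S, γl, hγ0, hγ1, hχlev, hlevKG, hlevN, U, hUK, hfU, hΛU⟩ :=
    exists_preimage_level_letters L e dV hdV dW hdW Λ hΛ hdV0 hdW0 h𝒦 hstd hcont hΛc KG hKGo
  refine ⟨S, γl, hγ0, hγ1, ?_⟩
  -- the growth of `b` (★ ED. 4 §1)
  obtain ⟨Cb, Ab, -, hAb, hbH⟩ := exists_norm_xi_det_levi_le L e dV hdV dW hdW 𝒦 χ hχ ξ hξ mx kx hkx hp hmx
  have hbH' : ∀ x : HA L e dV hdV dW hdW, ‖b x‖ ≤ Cb * (fun x : HA L e dV hdV dW hdW => adelicHeightGL (2 + 2) L (x : GL (Fin (2 + 2)) (AdeleRing (𝓞 L) L))) x ^ Ab :=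
    fun x => by rw [hb]; exact hbH x
  -- the per-translate `K_H`-types (§1)
  have hKH := exists_KHType_translates L e dV hdV dW hdW 𝒦 hstd hcont Λ νN β₁ w₀ F hF hint hFhol U hUK 0 hfU
  -- ★ I3 ED. 2 at `K_H := 𝒦.K`
  exact exists_KTypes_package_level S γl
    (fun x : HA L e dV hdV dW hdW => adelicHeightGL (2 + 2) L (x : GL (Fin (2 + 2)) (AdeleRing (𝓞 L) L))) (fun x => adelicHeightGL_pos_holds _)
    𝒦.K F a b Λ hΛc kx φ hφ hφT hφN KG hKGo hKGfi hΛK hkx U hKH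
    (K2LiuSiegelMiddleTermDetCharacter.ha_cont ξ a ha hξc) (K2LiuSiegelMiddleTermDetCharacter.ha_mul ξ a ha)
    (K2LiuSiegelMiddleTermDetCharacter.hCa ξ a ha χ hχ hξ) hAb hbH' (K2LiuSiegelMiddleTermDetCharacter.ha_lev ξ a ha χ hξ S γl hχlev) hΛU hlevKG hlevN

/-! ## §2 HEAD: the middle-cell term package of a standard family at the preimage level -/

set_option maxHeartbeats 400000 in
include hg₀ hΛ hΓ₀ hwq in
/-- **(u-0c) I4, ED. 5 — THE MIDDLE-CELL TERM PACKAGE `E₇` OF A STANDARD FAMILY AT THE PREIMAGE LEVEL (`n = 2`).**  Carrier `νN` (Haar on `N_Δ(𝔸)`), `β` an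
`N_Δ(L⁺)`-covering weight with `∫⁻β < ∞`, `β ≤ 𝟙_K`, `K` compact; the rational Weyl presentation `wq`; `χ` unitary and trivial on norms (`hχc`); `f` STANDARD for a STANDARD
datum `𝒦` (`𝒦.IsStd`) with continuous members; the DATUM of ★ α3-2 (`g₀`, the Levi chart `Λ` — continuous —, the stabiliser lattice `Γ₀` and a `Γ₀`-covering weight `β₁`);
an OPEN FINITE-INDEX `KG ≤ K_{GL₂}` with `Λ(KG) ⊆ 𝒦.K` (the desk's preimage-level block — at the tie `KG := Λ⁻¹(𝒦.K) ⊓ K_{GL₂}`); the inner section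
`F_s(y) = ∫ β₁(u) • f_s(w₀·(u·y)) dνN(u)` BY VALUE with its two analytic letters on ALL of `H(𝔸)` (`hint`: integrability for `0 < re s`; `hFhol`: holomorphy on `{0 < re}`):
**there is `E₇` with ★ ED. 2's `h7d`, `h7c`, `h7eq` (at `P = {½}`) and `h7g`** — the level letters from 📤 p862660 `exists_level_letters_of_blk_of_nhds` (at
`W₀ := {r | (1,r) ∈ O}`, `O ∩ K_{GL₂} = KG`), `hlevN` from ★ p862608 `exists_level_conj`, the per-translate `K_H`-types from §1, the `W`-package from I3 ED. 2
`K2LiuSiegelMiddleTermKTypesLevel` (K2Liu-p12), the rest as ★ ED. 4 (`ξ`, ★ I2, §1 `hb`, §2 laws, ★ (β0-hol), ★ `exists_rowSection₂`, ★ ED. 3, ★ ED. 2).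
[cite: MoeglinWaldspurger1995, II.1.7, IV.1.9] [cite: BorelJacquet1979, §1.1, §4.1] [cite: Tan1999, §4 Prop. 4.8] [cite: KudlaRallis1994, §2 (2.10)–(2.12)] -/
theorem exists_middleTerm_package_of_standard_level (hdV0 : ∀ i, dV i ≠ 0) (hdW0 : ∀ i, dW i ≠ 0)
    -- the carrier
    (νN : Measure (unipDelta L e dV hdV dW hdW)) [νN.IsHaarMeasure]
    (β : unipDelta L e dV hdV dW hdW → ℝ≥0∞) (hβ : IsCoveringWeight (unipDeltaRat L e dV hdV dW hdW) β) (hβtop : ∫⁻ u, β u ∂νN ≠ ∞)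
    {K : Set (unipDelta L e dV hdV dW hdW)} (hK : IsCompact K) (hβK : ∀ u, β u ≤ K.indicator 1 u)
    -- the character and the standard family at a standard datum
    {χ : HeckeCharacter L} (hχ : χ.IsUnitary)
    (hχc : ∀ d : (AdeleRing (𝓞 L) L)ˣ, χ (Units.map (conjAdele (Fp L) L (IsCMField.complexConj L) : AdeleRing (𝓞 L) L →* AdeleRing (𝓞 L) L) d) * χ d = 1)
    (𝒦 : IwasawaDatum L e dV hdV dW hdW) (h𝒦 : 𝒦.IsStd) (f : ℂ → HA L e dV hdV dW hdW → ℂ) (hstd : IsStandardSectionFamily 𝒦 χ f) (hcont : ∀ s : ℂ, Continuous (f s))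
    -- the chart letters: continuity and the preimage-level block
    (hΛc : Continuous Λ)
    (KG : Subgroup (GL (Fin 2) (AdeleRing (𝓞 L) L)))
    (hKGo : IsOpen ((KG.subgroupOf (standardMaximalCompactGL 2 L) : Subgroup ↥(standardMaximalCompactGL 2 L)) : Set ↥(standardMaximalCompactGL 2 L)))
    (hKGfi : (KG.subgroupOf (standardMaximalCompactGL 2 L)).FiniteIndex)
    (hΛK : ∀ k ∈ KG, Λ k ∈ 𝒦.K)
    {β₁ : unipDelta L e dV hdV dW hdW → ℝ≥0∞} (hβ₁ : IsCoveringWeight Γ₀ β₁)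
    -- the inner section of the middle cell, by value, with its two analytic letters on all of `H(𝔸)`
    (F : ℂ → HA L e dV hdV dW hdW → ℂ)
    (hF : ∀ (s : ℂ) (x : HA L e dV hdV dW hdW), F s x = ∫ u, (β₁ u).toReal • f s (iotaGG L e dV hdV dW hdW (1, UnitaryGroup.rationalPairToAdelic (Fp L) L (IsCMField.complexConj L) N M (Matrix.diagonal dV) (Matrix.diagonal dW) g₀) * ((u : HA L e dV hdV dW hdW) * x)) ∂νN)
    (hint : ∀ s : ℂ, 0 < s.re → ∀ y : HA L e dV hdV dW hdW,
      Integrable (fun u : unipDelta L e dV hdV dW hdW => (β₁ u).toReal • f s (iotaGG L e dV hdV dW hdW (1, UnitaryGroup.rationalPairToAdelic (Fp L) L (IsCMField.complexConj L) N M (Matrix.diagonal dV) (Matrix.diagonal dW) g₀) * ((u : HA L e dV hdV dW hdW) * y))) νN)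
    (hFhol : ∀ y : HA L e dV hdV dW hdW, DifferentiableOn ℂ (fun s => F s y) {s : ℂ | 0 < s.re}) :
    ∃ E₇ : ℂ → HA L e dV hdV dW hdW → ℂ,
      (∀ h : HA L e dV hdV dW hdW, DifferentiableOn ℂ (fun s => E₇ s h) {s : ℂ | 0 < s.re}) ∧
      (∀ s : ℂ, 0 < s.re → Continuous (E₇ s)) ∧
      (∀ (s : ℂ) (h : HA L e dV hdV dW hdW), ((2 : ℕ) : ℝ) / 2 < s.re →
        E₇ s h = (∏ p ∈ ({(1 / 2 : ℂ)} : Finset ℂ), (s - p)) * ∫ u, (β u).toReal •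
        (∑' q : ↥(({Quotient.mk (MulAction.orbitRel (siegelDeltaRat L e dV hdV dW hdW) (ratH L e dV hdV dW hdW)) 1} ∪
            Set.range (fun ν : unipDeltaRat L e dV hdV dW hdW =>
              (Quotient.mk (MulAction.orbitRel (siegelDeltaRat L e dV hdV dW hdW) (ratH L e dV hdV dW hdW)) (wq ν) :
                SiegelDeltaQuot L e dV hdV dW hdW)))ᶜ : Set (SiegelDeltaQuot L e dV hdV dW hdW)),
          f s ((((Quotient.out (q : SiegelDeltaQuot L e dV hdV dW hdW) : ratH L e dV hdV dW hdW) : HA L e dV hdV dW hdW)) *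
            ((u : HA L e dV hdV dW hdW) * h))) ∂νN) ∧
      (∀ z : ℂ, 0 < z.re → ∃ C A r : ℝ, 0 < r ∧ ∀ s : ℂ, dist s z < r → ∀ h : HA L e dV hdV dW hdW,
        ‖E₇ s h‖ ≤ C * adelicHeightGL (2 + 2) L (h : GL (Fin (2 + 2)) (AdeleRing (𝓞 L) L)) ^ A) := by
  haveI : NeZero (2 : ℕ) := ⟨two_ne_zero⟩
  have hf : ∀ s : ℂ, IsSiegelDeltaSection L e dV hdV dW hdW χ s (f s) := hstd.1.1
  -- (c) the untwisting character and the factor `a`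
  obtain ⟨ξ, hξ, hξc⟩ := exists_halfNormTwist χ
  obtain ⟨a, ha⟩ : ∃ a : GL (Fin 2) (AdeleRing (𝓞 L) L) → ℂ, ∀ g, a g = (((ξ (Matrix.GeneralLinearGroup.det g))⁻¹ : ℂˣ) : ℂ) := ⟨_, fun g => rfl⟩
  -- (d) the Iwasawa–Levi coordinate (★ I2) and the factor `b = ξ(det m_x)`
  obtain ⟨mx, kx, C₀, A₀, hC₀, hA₀, hkx, hp, hmx, hmxH⟩ := exists_iwasawaLeviCoordinate L e dV hdV dW hdW 𝒦
  obtain ⟨b, hb⟩ : ∃ b : HA L e dV hdV dW hdW → ℂ, ∀ x, b x = ((ξ (Matrix.GeneralLinearGroup.det (mx x)) : ℂˣ) : ℂ) := ⟨_, fun x => rfl⟩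
  -- (e) the untwisted inner family: Borel laws (★ ED. 4 §2), holomorphy (★ (β0-hol))
  obtain ⟨φ, hφ⟩ : ∃ φ : ℂ → HA L e dV hdV dW hdW → GL (Fin 2) (AdeleRing (𝓞 L) L) → ℂ, ∀ s x g, φ s x g = a g * b x * F s (Λ g * kx x) :=
    ⟨_, fun s x g => rfl⟩
  obtain ⟨hφT, hφN⟩ := innerFamily_laws L e dV hdV dW hdW hg₀ Λ hΛ Γ₀ hΓ₀ hdV0 hdW0 νN hβ₁ χ hχc f hf hcont F hF ξ hξ a ha b kx φ hφ
  have hφhol : ∀ (x : HA L e dV hdV dW hdW) (k : ↥(standardMaximalCompactGL 2 L)), DifferentiableOn ℂ (fun s => φ s x k) {s : ℂ | 0 < s.re} :=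
    fun x k => differentiableOn_phi₂ F hFhol a b Λ kx φ hφ x (k : GL (Fin 2) (AdeleRing (𝓞 L) L))
  -- (f)+(g) the level letters and the `W`-package at the preimage level (§1d: §1c + §1 + ★ I3 ED. 2)
  obtain ⟨S, γl, hγ0, hγ1, W, _, hWstab, hWlaw, hWlev, hWcont, hWext, hφW, hφbd⟩ :=
    exists_KTypes_package_of_standard_level L e dV hdV dW hdW Λ hΛ hdV0 hdW0 h𝒦 hχ hstd hcont hΛc KG hKGo hKGfi hΛK ξ hξ hξc a ha mx kx hkx hp hmx b hb νN β₁
      (iotaGG L e dV hdV dW hdW (1, UnitaryGroup.rationalPairToAdelic (Fp L) L (IsCMField.complexConj L) N M (Matrix.diagonal dV) (Matrix.diagonal dW) g₀))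
      F hF hint hFhol φ hφ hφT hφN
  -- (h) the row section (★ `exists_rowSection₂`), the identification `hMID` with `c₀ = 1` (★ ED. 3), and ★ ED. 2 at `n = 2`
  obtain ⟨γ, hγrow, hγrep⟩ := exists_rowSection₂ (K := L)
  have hξL := xi_det_map_eq_one χ ξ hξ
  have hMID := middleTerm_eq_tsum_untwisted hg₀ Λ hΛ Γ₀ hΓ₀ wq hwq hdV0 hdW0 νN hβ hβtop hK hβK hχ f hf hcont hβ₁ F hF γ hγrow mx kx hp hmx ξ hξL a ha b hb φ hφ
  refine exists_middleTerm_package' L e dV hdV dW hdW (n := 2) rfl hdV0 hdW0 S γl hγ0 hγ1 W hWstab hWlaw hWlev hWcont hWext φ hφT hφN hφW hφhol hφbd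
    mx hC₀ hA₀ hmxH γ hγrep νN β wq hχ f hf hcont hβ.measurable hK hβK 1 fun s h hs => hMID s h ?_
  rw [Nat.cast_ofNat] at hs
  linarith

end Summit.HodgeConjecture.HodgeConjecture.Cruxes.HLiu418.K2LiuSiegelEisensteinMiddleTermOfStandardLevel

end
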